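import Summits.AtomisticToContinuum.FouriersLaw.Theorems.EmbeddedDrudeMourreAbelThermodynamicLimitWitnessRegularisation
import Literature.MathematicalPhysics.KineticTheory.InfiniteChainGibbsExistenceShift

/-!
# `LatticeLandauDamping.AbelThermodynamicLimit`, line `series-law-at-every-laplace-frequency`:
# the witness-regularisation seam reduced to WITNESS TIGHTNESS + REGULARITY OF TIGHT DLR STATES

Support file for item `stmt-AtomisticToContinuum-14013` (crux
`Summit.AtomisticToContinuum.FouriersLaw.Theses.LatticeLandauDamping.AbelThermodynamicLimit`, which is
`Iff.rfl`-identical to the sibling crux `EmbeddedDrudeMourre.AbelThermodynamicLimit`, stmt-12596); closes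
nothing; proves the registered REDUCTION stub `stub_witnessRegularisationOfWitnessTightness` of the seam
`stub_witnessRegularisation` (shared verbatim by the lines of stmt-14013, stmt-12596 and
`GreenKuboContinuation` stmt-12597).

The seam: for `P = pinnedChain ω₂ lam β γ` (all `> 0`) and `T > 0`, IF some Abelian Green–Kubo witness
`(μT, D', κ)` exists at `T` — ANY DLR state `μT`, ANY `μT`-preserving `InfiniteChainDynamics D'` with
absolutely convergent current correlations, `κ > 0` the Abel limit of `T⁻² ∫₀^∞ e^{-νt} C_{D',μT}(t) dt` —
THEN a witness whose STATE is regular (DLR + shift-invariant + Buttà–Marchioro superstable) exists at `T`.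

## What is proved here (all proofs complete, no named fact)

* `stub_witnessRegularisationOfWitnessTightness` (registered on stmt-14013): the seam at `T` follows
  from the conjunction of
  (WT) WITNESS TIGHTNESS at `T`: the state of every Abelian Green–Kubo witness at `T` (all five witness
       clauses in the hypothesis: DLR, preservation, absolutely convergent correlations at every time,
       `0 < κ`, Abel limit `κ`) is one-site tight, `∀ ε > 0 ∃ R ∀ x, μ {R < |q_x|} ≤ ε`;
  (TR) TIGHT DLR STATES ARE REGULAR at `T`: a one-site-tight DLR state of `P` at `T` is shift-invariant
       and satisfies BM's superstability estimate (2.3).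
  Proof: the witness state is tight by (WT), regular by (TR); the witness itself is output, dynamics
  untouched.
* `witnessTight_of_dynamicallyTight`: (DT) ⇒ (WT), and `tightRegular_of_tightUnique`: (TU) ⇒ (TR), where
  (DT) "every DLR state at `T` preserved by some dynamics with absolutely convergent correlations is
  one-site tight" and (TU) "two one-site-tight DLR states at `T` coincide" are the two hypotheses of the
  sibling lead's registered reduction `stub_witnessRegularisationOfDynamicalTightness`
  (`Theorems/EmbeddedDrudeMourreAbelThermodynamicLimitWitnessRegularisation.lean`); (TU) ⇒ (TR) uses the
  tree's regular state `exists_isChainGibbsMeasure_shiftInvariant_superstable_pinnedChain` and its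
  tightness `oneSiteTight_of_hasSuperstabilityEstimate`. So the present residual (WT) ∧ (TR) is implied
  by the sibling's (DT) ∧ (TU): `witnessRegularisation_of_dynamicallyTight_of_tightUnique` re-derives the
  sibling's reduction from the present one (formally weaker residual, same seam).
* §4, `oneSiteTight_of_lintegral_sq_le` and `oneSiteTight_of_isShiftInvariant`: one-site tightness
  is implied outright (no DLR equation) by a bounded second-moment density `sup_x ∫ q_x² dμ < ∞`
  (Chebyshev) and by shift invariance of a finite measure (all one-site tails equal the tail at site
  `0`); with §1 of the sibling file (BM-superstable ⇒ tight) this makes (WT) the weakest of the natural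
  candidate residuals "witness states are tight / of finite energy density / shift-invariant /
  superstable".

## Status of the two residual hypotheses (diagnosis, 2026-08-16; nothing below is used in a proof)

* (TR) is theorem-grade and classical: under any DLR state the momenta are i.i.d. `N(0,T)` and the
  positions form the 1-D nearest-neighbour unbounded-spin chain with strictly positive Hilbert–Schmidt
  transfer kernel; the DLR equation in the volume `[-n, n]`, one-site tightness of the two boundary spins
  `q_{±(n+1)}` and the uniform-on-compacts convergence of the bridge's window marginals (Jentzsch gap of
  the ground-state-transformed transfer operator) identify a tight DLR state with the transfer-operator
  Markov state, which is shift-invariant and superstable (tree: `exists_transferMarkovState`,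
  `isShiftInvariant_of_windowDensity`, `hasSuperstabilityEstimate_of_windowDensity`).
  (Cassandro–Olivieri–Pellegrinotti–Presutti 1978 §2; Georgii 2011 Thm 10.25, §11.1.) It is the natural
  by-product of the registered uniqueness stub `stub_regularDLRUnique` when proved by the transfer
  operator, and (TU) implies both (TR) and `stub_regularDLRUnique` (regular ⇒ tight, §1 of the sibling
  file), so ONE tight-uniqueness theorem serves the whole seam.
* (WT) is the irreducible open content of the seam (the sibling's "R1"/(DT), here weakened to full
  witnesses). Nothing in `IsChainGibbsMeasure ∧ PreservesMeasure ∧ HasAbsConvergentCorrelation` is known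
  to force tightness: at the harmonic corner `lam = β = 0` (outside the stub's range, calibration only)
  the translate of the regular Gaussian state by a static equilibrium profile
  `m_x = A λ^x + B λ^{-x}` (`λ + λ⁻¹ = 2 + ω₂`) is a NON-tight DLR state, the affine flow
  `m + ξ ↦ m + φ_t ξ` preserves it, and its current correlations differ from the regular ones by
  `¼ d_0 d_x ⟨(p_0+p_1)(p_x+p_{x+1})(t)⟩` (`d_x = m_{x+1} - m_x` geometric, the momentum propagator
  super-exponentially small beyond the sound cone), which is absolutely summable (a paper-level
  computation, not formalised) — so the analogue of (DT) FAILS there, and only the Abel clause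
  (violated at the harmonic corner: Drude floor from the conserved normal modes, Mazur;
  `not_tendsto_of_drude_floor`) excludes it; a proof of (WT) must use `lam, β > 0` AND plausibly the
  Abel clause, which is why (WT) carries all five witness clauses. No printed source decides (WT).
* Recommended resolution (planner level, unchanged from the sibling's note): quantify the crux's witness
  clause over REGULAR states, after which the seam is the identity.
-/

noncomputable section

namespace Summit.AtomisticToContinuum.FouriersLaw.Theorems.AbelThermodynamicLimit.SeriesLawAtEveryLaplaceFrequency

open MeasureTheory Filter Set
open scoped ENNReal
open Literature.MathematicalPhysics.KineticTheory.HeatConduction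
open Summit.AtomisticToContinuum.FouriersLaw.Theorems.AbelThermodynamicLimit.LoomisCompactHorizonWitness
  (oneSiteTight_of_hasSuperstabilityEstimate)

/-! ## §1 The two residual hypotheses are implied by the sibling's (DT) and (TU) -/

/-- **(DT) ⇒ (WT).** Dynamical tightness (every DLR state at `T` preserved by some dynamics with
absolutely convergent current correlations is one-site tight) implies witness tightness (the same for
states of full Abelian Green–Kubo witnesses): drop the two Abel clauses. [folklore] -/
theorem witnessTight_of_dynamicallyTight {ω₂ lam β γ T : ℝ}
    (hDT : ∀ (μ : Measure ChainConfig) (D : InfiniteChainDynamics (pinnedChain ω₂ lam β γ)),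
      (pinnedChain ω₂ lam β γ).IsChainGibbsMeasure T μ → D.PreservesMeasure μ →
      (∀ t : ℝ, D.HasAbsConvergentCorrelation μ t) →
      ∀ ε : ℝ, 0 < ε → ∃ R : ℝ, ∀ x : ℤ,
        μ {σ : ChainConfig | R < |(σ x).1|} ≤ ENNReal.ofReal ε) :
    ∀ (μ : Measure ChainConfig) (D : InfiniteChainDynamics (pinnedChain ω₂ lam β γ)) (κ : ℝ),
      (pinnedChain ω₂ lam β γ).IsChainGibbsMeasure T μ → D.PreservesMeasure μ →
      (∀ t : ℝ, D.HasAbsConvergentCorrelation μ t) → 0 < κ →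
      Tendsto (fun ν : ℝ => (T ^ 2)⁻¹ *
          ∫ t in Ioi (0 : ℝ), Real.exp (-(ν * t)) * D.currentCorrelation μ t)
        (nhdsWithin (0 : ℝ) (Ioi 0)) (nhds κ) →
      ∀ ε : ℝ, 0 < ε → ∃ R : ℝ, ∀ x : ℤ,
        μ {σ : ChainConfig | R < |(σ x).1|} ≤ ENNReal.ofReal ε :=
  fun μ D _κ hG hP hAC _ _ => hDT μ D hG hP hAC

/-- **(TU) ⇒ (TR).** If any two one-site-tight DLR states of the pinned chain (`ω₂ > 0`,
`lam, β ≥ 0`) at `T > 0` coincide, then every one-site-tight DLR state at `T` is shift-invariant and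
satisfies BM's superstability estimate: it equals the transfer-operator state of the tree
(`exists_isChainGibbsMeasure_shiftInvariant_superstable_pinnedChain`), which is regular, and tight by
`oneSiteTight_of_hasSuperstabilityEstimate`. [folklore] -/
theorem tightRegular_of_tightUnique {ω₂ lam β : ℝ} (γ : ℝ) (hω : 0 < ω₂) (hl : 0 ≤ lam)
    (hβ : 0 ≤ β) {T : ℝ} (hT : 0 < T)
    (hTU : ∀ μ₁ μ₂ : Measure ChainConfig,
      (pinnedChain ω₂ lam β γ).IsChainGibbsMeasure T μ₁ →
      (∀ ε : ℝ, 0 < ε → ∃ R : ℝ, ∀ x : ℤ,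
        μ₁ {σ : ChainConfig | R < |(σ x).1|} ≤ ENNReal.ofReal ε) →
      (pinnedChain ω₂ lam β γ).IsChainGibbsMeasure T μ₂ →
      (∀ ε : ℝ, 0 < ε → ∃ R : ℝ, ∀ x : ℤ,
        μ₂ {σ : ChainConfig | R < |(σ x).1|} ≤ ENNReal.ofReal ε) →
      μ₁ = μ₂) :
    ∀ μ : Measure ChainConfig, (pinnedChain ω₂ lam β γ).IsChainGibbsMeasure T μ →
      (∀ ε : ℝ, 0 < ε → ∃ R : ℝ, ∀ x : ℤ,
        μ {σ : ChainConfig | R < |(σ x).1|} ≤ ENNReal.ofReal ε) →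
      IsShiftInvariant μ ∧ (pinnedChain ω₂ lam β γ).HasSuperstabilityEstimate μ := by
  intro μ hG hμt
  obtain ⟨μr, hGr, hSr, hssr⟩ :=
    OscillatorChain.exists_isChainGibbsMeasure_shiftInvariant_superstable_pinnedChain γ hω hl hβ hT
  have htr := oneSiteTight_of_hasSuperstabilityEstimate γ hω hl hβ hssr
  have heq : μ = μr := hTU μ μr hG hμt hGr htr
  subst heq
  exact ⟨hSr, hssr⟩

/-! ## §2 The registered reduction -/

/-- **`stub_witnessRegularisationOfWitnessTightness`** (registered on stmt-AtomisticToContinuum-14013;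
reduction of the seam `stub_witnessRegularisation`, line SketchIdeator2). For `P = pinnedChain ω₂ lam β γ`
(all `> 0`) and `T > 0`: IF
(WT) the state of every Abelian Green–Kubo witness `(μ, D, κ)` at `T` is one-site tight, and
(TR) every one-site-tight DLR state of `P` at `T` is shift-invariant and satisfies BM (2.3),
THEN the seam holds at `T`: an arbitrary witness `(μT, D', κ)` is itself a witness with regular state.
(WT) is the open residual; (TR) is the transfer-operator uniqueness theorem (COPP 1978 §2, Georgii 2011
Thm 10.25) in the form the seam consumes. [folklore] -/
theorem stub_witnessRegularisationOfWitnessTightness :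
    ∀ ω₂ lam β γ : ℝ, 0 < ω₂ → 0 < lam → 0 < β → 0 < γ →
      ∀ T : ℝ, 0 < T →
        (∀ (μ : MeasureTheory.Measure
                Literature.MathematicalPhysics.KineticTheory.HeatConduction.ChainConfig)
            (D : Literature.MathematicalPhysics.KineticTheory.HeatConduction.InfiniteChainDynamics
              (Literature.MathematicalPhysics.KineticTheory.HeatConduction.pinnedChain ω₂ lam β γ))
            (κ : ℝ),
            (Literature.MathematicalPhysics.KineticTheory.HeatConduction.pinnedChain
                ω₂ lam β γ).IsChainGibbsMeasure T μ → D.PreservesMeasure μ →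
            (∀ t : ℝ, D.HasAbsConvergentCorrelation μ t) → 0 < κ →
            Filter.Tendsto (fun ν : ℝ => (T ^ 2)⁻¹ *
              MeasureTheory.integral (MeasureTheory.volume.restrict (Set.Ioi (0:ℝ)))
                (fun t : ℝ => Real.exp (-(ν * t)) * D.currentCorrelation μ t))
              (nhdsWithin (0:ℝ) (Set.Ioi 0)) (nhds κ) →
            ∀ ε : ℝ, 0 < ε → ∃ R : ℝ, ∀ x : ℤ,
              μ {σ : Literature.MathematicalPhysics.KineticTheory.HeatConduction.ChainConfig |
                  R < |(σ x).1|} ≤ ENNReal.ofReal ε) →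
        (∀ μ : MeasureTheory.Measure
                Literature.MathematicalPhysics.KineticTheory.HeatConduction.ChainConfig,
            (Literature.MathematicalPhysics.KineticTheory.HeatConduction.pinnedChain
                ω₂ lam β γ).IsChainGibbsMeasure T μ →
            (∀ ε : ℝ, 0 < ε → ∃ R : ℝ, ∀ x : ℤ,
              μ {σ : Literature.MathematicalPhysics.KineticTheory.HeatConduction.ChainConfig |
                  R < |(σ x).1|} ≤ ENNReal.ofReal ε) →
            Literature.MathematicalPhysics.KineticTheory.HeatConduction.IsShiftInvariant μ ∧
            (Literature.MathematicalPhysics.KineticTheory.HeatConduction.pinnedChain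
                ω₂ lam β γ).HasSuperstabilityEstimate μ) →
        (∃ (μT : MeasureTheory.Measure
                Literature.MathematicalPhysics.KineticTheory.HeatConduction.ChainConfig)
            (D' : Literature.MathematicalPhysics.KineticTheory.HeatConduction.InfiniteChainDynamics
              (Literature.MathematicalPhysics.KineticTheory.HeatConduction.pinnedChain ω₂ lam β γ))
            (κ : ℝ),
            (Literature.MathematicalPhysics.KineticTheory.HeatConduction.pinnedChain
                ω₂ lam β γ).IsChainGibbsMeasure T μT ∧ D'.PreservesMeasure μT ∧
            (∀ t : ℝ, D'.HasAbsConvergentCorrelation μT t) ∧ 0 < κ ∧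
            Filter.Tendsto (fun ν : ℝ => (T ^ 2)⁻¹ *
              MeasureTheory.integral (MeasureTheory.volume.restrict (Set.Ioi (0:ℝ)))
                (fun t : ℝ => Real.exp (-(ν * t)) * D'.currentCorrelation μT t))
              (nhdsWithin (0:ℝ) (Set.Ioi 0)) (nhds κ)) →
        ∃ (μT : MeasureTheory.Measure
                Literature.MathematicalPhysics.KineticTheory.HeatConduction.ChainConfig)
            (D' : Literature.MathematicalPhysics.KineticTheory.HeatConduction.InfiniteChainDynamics
              (Literature.MathematicalPhysics.KineticTheory.HeatConduction.pinnedChain ω₂ lam β γ))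
            (κ : ℝ),
            (Literature.MathematicalPhysics.KineticTheory.HeatConduction.pinnedChain
                ω₂ lam β γ).IsChainGibbsMeasure T μT ∧
            Literature.MathematicalPhysics.KineticTheory.HeatConduction.IsShiftInvariant μT ∧
            (Literature.MathematicalPhysics.KineticTheory.HeatConduction.pinnedChain
                ω₂ lam β γ).HasSuperstabilityEstimate μT ∧
            D'.PreservesMeasure μT ∧
            (∀ t : ℝ, D'.HasAbsConvergentCorrelation μT t) ∧ 0 < κ ∧
            Filter.Tendsto (fun ν : ℝ => (T ^ 2)⁻¹ *
              MeasureTheory.integral (MeasureTheory.volume.restrict (Set.Ioi (0:ℝ)))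
                (fun t : ℝ => Real.exp (-(ν * t)) * D'.currentCorrelation μT t))
              (nhdsWithin (0:ℝ) (Set.Ioi 0)) (nhds κ) := by
  intro ω₂ lam β γ _hω _hl _hβ _hγ T _hT hWT hTR hwit
  obtain ⟨μT, D', κ, hG, hP, hAC, hκ, hlim⟩ := hwit
  have htight := hWT μT D' κ hG hP hAC hκ hlim
  obtain ⟨hS, hss⟩ := hTR μT hG htight
  exact ⟨μT, D', κ, hG, hS, hss, hP, hAC, hκ, hlim⟩

/-! ## §3 The sibling's reduction, re-derived from the present one -/

/-- **(DT) ∧ (TU) ⇒ the seam**, i.e. the statement of the sibling lead's registered reduction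
`stub_witnessRegularisationOfDynamicalTightness` (stmt-12596), obtained here from
`stub_witnessRegularisationOfWitnessTightness` via `witnessTight_of_dynamicallyTight` and
`tightRegular_of_tightUnique`: the present residual (WT) ∧ (TR) is formally weaker. [folklore] -/
theorem witnessRegularisation_of_dynamicallyTight_of_tightUnique {ω₂ lam β γ : ℝ}
    (hω : 0 < ω₂) (hl : 0 < lam) (hβ : 0 < β) (hγ : 0 < γ) {T : ℝ} (hT : 0 < T)
    (hDT : ∀ (μ : Measure ChainConfig) (D : InfiniteChainDynamics (pinnedChain ω₂ lam β γ)),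
      (pinnedChain ω₂ lam β γ).IsChainGibbsMeasure T μ → D.PreservesMeasure μ →
      (∀ t : ℝ, D.HasAbsConvergentCorrelation μ t) →
      ∀ ε : ℝ, 0 < ε → ∃ R : ℝ, ∀ x : ℤ,
        μ {σ : ChainConfig | R < |(σ x).1|} ≤ ENNReal.ofReal ε)
    (hTU : ∀ μ₁ μ₂ : Measure ChainConfig,
      (pinnedChain ω₂ lam β γ).IsChainGibbsMeasure T μ₁ →
      (∀ ε : ℝ, 0 < ε → ∃ R : ℝ, ∀ x : ℤ,
        μ₁ {σ : ChainConfig | R < |(σ x).1|} ≤ ENNReal.ofReal ε) →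
      (pinnedChain ω₂ lam β γ).IsChainGibbsMeasure T μ₂ →
      (∀ ε : ℝ, 0 < ε → ∃ R : ℝ, ∀ x : ℤ,
        μ₂ {σ : ChainConfig | R < |(σ x).1|} ≤ ENNReal.ofReal ε) →
      μ₁ = μ₂)
    (hwit : ∃ (μT : Measure ChainConfig) (D' : InfiniteChainDynamics (pinnedChain ω₂ lam β γ))
        (κ : ℝ),
      (pinnedChain ω₂ lam β γ).IsChainGibbsMeasure T μT ∧ D'.PreservesMeasure μT ∧
      (∀ t : ℝ, D'.HasAbsConvergentCorrelation μT t) ∧ 0 < κ ∧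
      Tendsto (fun ν : ℝ => (T ^ 2)⁻¹ *
          ∫ t in Ioi (0 : ℝ), Real.exp (-(ν * t)) * D'.currentCorrelation μT t)
        (nhdsWithin (0 : ℝ) (Ioi 0)) (nhds κ)) :
    ∃ (μT : Measure ChainConfig) (D' : InfiniteChainDynamics (pinnedChain ω₂ lam β γ)) (κ : ℝ),
      (pinnedChain ω₂ lam β γ).IsChainGibbsMeasure T μT ∧ IsShiftInvariant μT ∧
      (pinnedChain ω₂ lam β γ).HasSuperstabilityEstimate μT ∧ D'.PreservesMeasure μT ∧
      (∀ t : ℝ, D'.HasAbsConvergentCorrelation μT t) ∧ 0 < κ ∧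
      Tendsto (fun ν : ℝ => (T ^ 2)⁻¹ *
          ∫ t in Ioi (0 : ℝ), Real.exp (-(ν * t)) * D'.currentCorrelation μT t)
        (nhdsWithin (0 : ℝ) (Ioi 0)) (nhds κ) :=
  stub_witnessRegularisationOfWitnessTightness ω₂ lam β γ hω hl hβ hγ T hT
    (witnessTight_of_dynamicallyTight hDT) (tightRegular_of_tightUnique γ hω hl.le hβ.le hT hTU) hwit

/-! ## §4 Two cheaper sufficient conditions for the tightness residual

(WT) asks only one-site tightness of witness states. Both classical regularity notions one might try to
establish for a witness state instead — finite position-moment density and translation invariance —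
imply it outright (no DLR equation needed), so (WT) is the weakest of the three candidate residuals. -/

/-- The one-site tail events are measurable. [folklore] -/
theorem measurableSet_tail (R : ℝ) (x : ℤ) :
    MeasurableSet {σ : ChainConfig | R < |(σ x).1|} :=
  measurableSet_lt measurable_const (continuous_abs.measurable.comp (measurable_pi_apply x).fst)

/-- **Bounded second-moment density ⇒ one-site tight** (Chebyshev): if
`sup_x ∫ q_x² dμ ≤ M < ∞` then `∀ ε > 0 ∃ R ∀ x, μ {R < |q_x|} ≤ ε`. In particular (WT) follows from
"witness states have bounded pinning-energy density". [folklore] -/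
theorem oneSiteTight_of_lintegral_sq_le {μ : Measure ChainConfig} {M : ℝ≥0∞} (hM : M ≠ ∞)
    (h : ∀ x : ℤ, ∫⁻ σ, ENNReal.ofReal ((σ x).1 ^ 2) ∂μ ≤ M) :
    ∀ ε : ℝ, 0 < ε → ∃ R : ℝ, ∀ x : ℤ,
      μ {σ : ChainConfig | R < |(σ x).1|} ≤ ENNReal.ofReal ε := by
  intro ε hε
  set m : ℝ := M.toReal with hm
  have hm0 : 0 ≤ m := ENNReal.toReal_nonneg
  have hMeq : M = ENNReal.ofReal m := (ENNReal.ofReal_toReal hM).symm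
  set R : ℝ := Real.sqrt (m / ε) + 1 with hR
  have hR0 : 0 < R := by positivity
  have hR2 : m / ε ≤ R ^ 2 := by
    have hs : Real.sqrt (m / ε) ^ 2 = m / ε := Real.sq_sqrt (by positivity)
    nlinarith [Real.sqrt_nonneg (m / ε)]
  refine ⟨R, fun x => ?_⟩
  have hmeas : AEMeasurable (fun σ : ChainConfig => ENNReal.ofReal ((σ x).1 ^ 2)) μ :=
    (ENNReal.measurable_ofReal.comp ((measurable_pi_apply x).fst.pow_const 2)).aemeasurable
  have hsub : {σ : ChainConfig | R < |(σ x).1|} ⊆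
      {σ : ChainConfig | ENNReal.ofReal (R ^ 2) ≤ ENNReal.ofReal ((σ x).1 ^ 2)} := by
    intro σ hσ
    have hσ' : R < |(σ x).1| := hσ
    have habs : |R| ≤ |(σ x).1| := by rw [abs_of_pos hR0]; exact hσ'.le
    exact ENNReal.ofReal_le_ofReal (sq_le_sq.mpr habs)
  have hne0 : ENNReal.ofReal (R ^ 2) ≠ 0 := (ENNReal.ofReal_pos.mpr (by positivity)).ne'
  calc μ {σ : ChainConfig | R < |(σ x).1|}
      ≤ μ {σ : ChainConfig | ENNReal.ofReal (R ^ 2) ≤ ENNReal.ofReal ((σ x).1 ^ 2)} :=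
        measure_mono hsub
    _ ≤ (∫⁻ σ, ENNReal.ofReal ((σ x).1 ^ 2) ∂μ) / ENNReal.ofReal (R ^ 2) :=
        meas_ge_le_lintegral_div hmeas hne0 ENNReal.ofReal_ne_top
    _ ≤ M / ENNReal.ofReal (R ^ 2) := ENNReal.div_le_div_right (h x) _
    _ ≤ ENNReal.ofReal ε := by
        rw [ENNReal.div_le_iff_le_mul (Or.inl hne0) (Or.inl ENNReal.ofReal_ne_top), hMeq,
          ← ENNReal.ofReal_mul hε.le]
        apply ENNReal.ofReal_le_ofReal
        have : m ≤ ε * (m / ε) := by field_simp; exact le_rfl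
        exact this.trans (mul_le_mul_of_nonneg_left hR2 hε.le)

/-- **Shift-invariant finite measures are one-site tight**: all one-site tail probabilities coincide
with the one at site `0`, which tends to `0` along `R → ∞` (continuity from above). In particular (WT)
follows from "witness states are shift-invariant". [folklore] -/
theorem oneSiteTight_of_isShiftInvariant {μ : Measure ChainConfig} [IsFiniteMeasure μ]
    (hS : IsShiftInvariant μ) :
    ∀ ε : ℝ, 0 < ε → ∃ R : ℝ, ∀ x : ℤ,
      μ {σ : ChainConfig | R < |(σ x).1|} ≤ ENNReal.ofReal ε := by
  have hstep : ∀ (R : ℝ) (x : ℤ),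
      μ {σ : ChainConfig | R < |(σ (x + 1)).1|} = μ {σ : ChainConfig | R < |(σ x).1|} := by
    intro R x
    have hpre : {σ : ChainConfig | R < |(σ (x + 1)).1|} =
        shift ⁻¹' {σ : ChainConfig | R < |(σ x).1|} := rfl
    rw [hpre, ← Measure.map_apply measurable_shift (measurableSet_tail R x)]
    unfold IsShiftInvariant at hS
    rw [hS]
  have hall : ∀ (R : ℝ) (x : ℤ),
      μ {σ : ChainConfig | R < |(σ x).1|} = μ {σ : ChainConfig | R < |(σ 0).1|} := by
    intro R x
    induction x with
    | zero => rfl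
    | succ i ih => rw [hstep, ih]
    | pred i ih =>
        rw [← ih, ← hstep R (-(i : ℤ) - 1)]
        congr 2
        ext σ
        simp only [sub_add_cancel]
  have hanti : Antitone fun n : ℕ => {σ : ChainConfig | (n : ℝ) < |(σ 0).1|} := by
    intro m n hmn σ hσ
    have hσ' : (n : ℝ) < |(σ 0).1| := hσ
    show (m : ℝ) < |(σ 0).1|
    exact lt_of_le_of_lt (Nat.cast_le.mpr hmn) hσ'
  have hinter : (⋂ n : ℕ, {σ : ChainConfig | (n : ℝ) < |(σ 0).1|}) = ∅ := by
    ext σ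
    simp only [mem_iInter, mem_setOf_eq, mem_empty_iff_false, iff_false, not_forall, not_lt]
    exact ⟨⌈|(σ 0).1|⌉₊, Nat.le_ceil _⟩
  have htend : Tendsto (fun n : ℕ => μ {σ : ChainConfig | (n : ℝ) < |(σ 0).1|}) atTop
      (nhds 0) := by
    have h := tendsto_measure_iInter_atTop (μ := μ)
      (fun n : ℕ => (measurableSet_tail (n : ℝ) 0).nullMeasurableSet) hanti
      ⟨0, measure_ne_top μ _⟩
    rwa [hinter, measure_empty] at h
  intro ε hε
  have hε' : (0 : ℝ≥0∞) < ENNReal.ofReal ε := ENNReal.ofReal_pos.mpr hε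
  obtain ⟨N, hN⟩ := (htend.eventually (Iio_mem_nhds hε')).exists
  refine ⟨N, fun x => ?_⟩
  rw [hall]
  exact (le_of_lt hN)

end Summit.AtomisticToContinuum.FouriersLaw.Theorems.AbelThermodynamicLimit.SeriesLawAtEveryLaplaceFrequency

end
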